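import Mathlib
import Summits.MatrixMultiplication.MatrixMultiplication.Theorems.FidelityWitnessesFidelityGapThreeSeventeenStubBorelNormalFormExp

/-!
# Borel normal form, part 4: the unipotent translate — quasi-inverse and multiplicativity

Support file for `stub_borelNormalForm` (line `symbolic-square-border-apolarity` of
`FidelityWitnesses.FidelityGapThreeSeventeen`).  For the scaled truncated exponential `Hx D N` of part 3:
`Hx (-D) N ∘ Hx D N = ε^{2N}` on families killed by `D^{N+1}` (the binomial identity
`∑ (-1)ʲ/(j!(k-j)!) = [k = 0]`), and, for a derivation `D`, `Hx D N F · Hx D N G = ε^N Hx D N (F G)` when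
`D^a F = 0`, `D^b G = 0`, `a + b ≤ N + 2` (generalised Leibniz rule + Cauchy regrouping of the truncated
double sum).  General, PROVED.
-/

noncomputable section

namespace Summit.MatrixMultiplication.MatrixMultiplication.Theorems.SymbolicSquare

-- single-conjunct summit: the `Summit.<S>.<P>` prefix repeats `MatrixMultiplication` by design (D-0017)
set_option linter.dupNamespace false

open scoped BigOperators Polynomial
open Polynomial

/-! ## The unipotent translate: quasi-inverse `exp(-D/ε) exp(D/ε) = 1` and multiplicativity -/

namespace BorelLimit

universe u v

variable {K : Type u} [Field K] {σ : Type v}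

open Finset in
/-- `1/(j! (k-j)!) = C(k,j)/k!` in a field of characteristic zero. -/
theorem inv_fact_mul_inv_fact [CharZero K] {j k : ℕ} (h : j ≤ k) :
    ((j.factorial : K)⁻¹) * (((k - j).factorial : K)⁻¹) = ((k.factorial : K)⁻¹) * (k.choose j : K) := by
  have h1 := Nat.choose_mul_factorial_mul_factorial h
  have h2 : (k.choose j : K) * (j.factorial : K) * ((k - j).factorial : K) = (k.factorial : K) := by
    exact_mod_cast h1
  have hj : (j.factorial : K) ≠ 0 := by exact_mod_cast Nat.factorial_ne_zero j
  have hkj : ((k - j).factorial : K) ≠ 0 := by exact_mod_cast Nat.factorial_ne_zero (k - j)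
  have hk : (k.factorial : K) ≠ 0 := by exact_mod_cast Nat.factorial_ne_zero k
  field_simp
  linear_combination -h2

open Finset in
/-- The binomial identity behind `exp(-y) exp(y) = 1`: `∑ⱼ (-1)ʲ/(j!(k-j)!) = [k = 0]`. -/
theorem sum_alt_inv_fact [CharZero K] (k : ℕ) :
    ∑ j ∈ range (k + 1), ((j.factorial : K)⁻¹) * (-1) ^ j * (((k - j).factorial : K)⁻¹) =
      if k = 0 then 1 else 0 := by
  have h : ∀ j ∈ range (k + 1), ((j.factorial : K)⁻¹) * (-1) ^ j * (((k - j).factorial : K)⁻¹) =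
      (k.factorial : K)⁻¹ * ((-1) ^ j * (1 : K) ^ (k - j) * (k.choose j : K)) := by
    intro j hj
    have hjk : j ≤ k := Nat.lt_succ_iff.1 (mem_range.1 hj)
    rw [mul_right_comm, inv_fact_mul_inv_fact hjk]
    ring
  rw [sum_congr rfl h, ← mul_sum, ← add_pow]
  rcases Nat.eq_zero_or_pos k with rfl | hk
  · simp
  · rw [if_neg hk.ne', neg_add_cancel, zero_pow hk.ne', mul_zero]

open Finset in
/-- Reindexing a triangular double sum by the total degree. -/
theorem sum_range_triangle {M : Type*} [AddCommMonoid M] (g : ℕ → ℕ → M) (N : ℕ) :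
    ∑ j ∈ range (N + 1), ∑ l ∈ range (N + 1 - j), g j l =
      ∑ k ∈ range (N + 1), ∑ j ∈ range (k + 1), g j (k - j) := by
  have h1 : ∀ j ∈ range (N + 1), ∑ l ∈ range (N + 1 - j), g j l = ∑ k ∈ Ico j (N + 1), g j (k - j) := by
    intro j _
    rw [sum_Ico_eq_sum_range]
    refine sum_congr rfl fun l _ => ?_
    rw [Nat.add_sub_cancel_left]
  rw [sum_congr rfl h1]
  refine sum_comm' (fun j k => ?_)
  simp only [mem_range, mem_Ico]
  omega

open Finset in
/-- **Cauchy regrouping with truncation**: a square double sum whose terms vanish in total degree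
`> N` equals the sum over total degrees `k ≤ N`. -/
theorem sum_range_sq_eq_triangle {M : Type*} [AddCommMonoid M] (g : ℕ → ℕ → M) (N : ℕ)
    (hg : ∀ j l, N + 1 ≤ j + l → g j l = 0) :
    ∑ j ∈ range (N + 1), ∑ l ∈ range (N + 1), g j l = ∑ k ∈ range (N + 1), ∑ j ∈ range (k + 1), g j (k - j) := by
  rw [← sum_range_triangle]
  refine sum_congr rfl fun j hj => ?_
  symm
  apply sum_subset
  · exact range_subset_range.2 (by omega)
  · intro l hl hl'
    simp only [mem_range, not_lt] at hl hl'
    exact hg j l (by omega)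

section ExpAlg

variable (D : MvPolynomial σ K →ₗ[K] MvPolynomial σ K) (N : ℕ)

/-- `cw` is homogeneous in the map. -/
theorem cw_smul (c : K) (ψ : MvPolynomial σ K →ₗ[K] MvPolynomial σ K) : cw (c • ψ) = c • cw ψ := by
  apply LinearMap.ext
  intro F
  ext t
  simp only [coeff_cw, LinearMap.smul_apply, coeff_smul]

/-- Powers of `cw (-D)`. -/
theorem cwpow_neg (j : ℕ) (G : (MvPolynomial σ K)[X]) : (cw (-D) ^ j) G = ((-1 : K) ^ j) • (cw D ^ j) G := by
  rw [← cw_pow, show -D = (-1 : K) • D from (neg_one_smul K D).symm, _root_.smul_pow, cw_smul,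
    LinearMap.smul_apply, cw_pow]

/-- **Quasi-inverse**: `exp(-D/ε) ∘ exp(D/ε) = 1`, scaled: `Hx (-D) N (Hx D N F) = ε^{2N} F` on `S[ε]` when
`D^{N+1} S = 0`. -/
theorem Hx_neg_Hx [CharZero K] {S : Submodule K (MvPolynomial σ K)} (hnil : ∀ f ∈ S, (D ^ (N + 1)) f = 0)
    {F : (MvPolynomial σ K)[X]} (hF : F ∈ famOf S) : Hx (-D) N (Hx D N F) = X ^ (2 * N) * F := by
  set g : ℕ → ℕ → (MvPolynomial σ K)[X] := fun j l =>
    ((j.factorial : K)⁻¹ * (-1) ^ j * (l.factorial : K)⁻¹) • (X ^ (N - j) * (X ^ (N - l) * (cw D ^ (j + l)) F))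
    with hg
  have hexp : Hx (-D) N (Hx D N F) = ∑ j ∈ Finset.range (N + 1), ∑ l ∈ Finset.range (N + 1), g j l := by
    rw [Hx_apply]
    refine Finset.sum_congr rfl fun j _ => ?_
    rw [cwpow_neg, Hx_apply, map_sum, Finset.smul_sum, Finset.mul_sum, Finset.smul_sum]
    refine Finset.sum_congr rfl fun l _ => ?_
    rw [hg]
    simp only
    rw [map_smul, cwpow_X_pow_mul, ← Module.End.mul_apply, ← pow_add, smul_smul, mul_smul_comm, smul_smul,
      ← mul_assoc]
  have hvan : ∀ j l, N + 1 ≤ j + l → g j l = 0 := by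
    intro j l hjl
    rw [hg]
    simp only
    rw [cwpow_eq_zero D hnil hjl hF, mul_zero, mul_zero, smul_zero]
  rw [hexp, sum_range_sq_eq_triangle g N hvan]
  have hinner : ∀ k ∈ Finset.range (N + 1), ∑ j ∈ Finset.range (k + 1), g j (k - j) =
      (if k = 0 then (1 : K) else 0) • (X ^ (2 * N - k) * (cw D ^ k) F) := by
    intro k hk
    have hkN : k ≤ N := Nat.lt_succ_iff.1 (Finset.mem_range.1 hk)
    rw [← sum_alt_inv_fact, Finset.sum_smul]
    refine Finset.sum_congr rfl fun j hj => ?_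
    have hjk : j ≤ k := Nat.lt_succ_iff.1 (Finset.mem_range.1 hj)
    rw [hg]
    simp only
    rw [Nat.add_sub_cancel' hjk, ← mul_assoc, ← pow_add, show N - j + (N - (k - j)) = 2 * N - k by omega]
  rw [Finset.sum_congr rfl hinner]
  simp only [ite_smul, one_smul, zero_smul]
  rw [Finset.sum_ite_eq']
  simp

/-- The same quasi-inverse in the other order: `Hx D N (Hx (-D) N F) = ε^{2N} F`. -/
theorem Hx_Hx_neg [CharZero K] {S : Submodule K (MvPolynomial σ K)} (hnil : ∀ f ∈ S, (D ^ (N + 1)) f = 0)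
    {F : (MvPolynomial σ K)[X]} (hF : F ∈ famOf S) : Hx D N (Hx (-D) N F) = X ^ (2 * N) * F := by
  have hnil' : ∀ f ∈ S, ((-D) ^ (N + 1)) f = 0 := by
    intro g hg
    rw [show -D = (-1 : K) • D from (neg_one_smul K D).symm, _root_.smul_pow, LinearMap.smul_apply, hnil g hg,
      smul_zero]
  have h := Hx_neg_Hx (-D) N hnil' hF
  rwa [neg_neg] at h

/-- **Multiplicativity**: `exp(D/ε)` is an algebra map when `D` is a derivation, scaled:
`Hx F · Hx G = ε^N Hx (F G)` for `F ∈ S₁[ε]`, `G ∈ S₂[ε]` with `D^a S₁ = 0`, `D^b S₂ = 0`, `a + b ≤ N + 2`. -/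
theorem Hx_mul [CharZero K] (hD : ∀ f g : MvPolynomial σ K, D (f * g) = D f * g + f * D g)
    {S₁ S₂ : Submodule K (MvPolynomial σ K)} {a b : ℕ}
    (ha : ∀ f ∈ S₁, (D ^ a) f = 0) (hb : ∀ g ∈ S₂, (D ^ b) g = 0) (hab : a + b ≤ N + 2)
    {F G : (MvPolynomial σ K)[X]} (hF : F ∈ famOf S₁) (hG : G ∈ famOf S₂) :
    Hx D N F * Hx D N G = X ^ N * Hx D N (F * G) := by
  set g : ℕ → ℕ → (MvPolynomial σ K)[X] := fun j l =>
    ((j.factorial : K)⁻¹ * (l.factorial : K)⁻¹) • (X ^ (N - j) * X ^ (N - l) * ((cw D ^ j) F * (cw D ^ l) G))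
    with hg
  have hexp : Hx D N F * Hx D N G = ∑ j ∈ Finset.range (N + 1), ∑ l ∈ Finset.range (N + 1), g j l := by
    rw [Hx_apply, Hx_apply, Finset.sum_mul_sum]
    refine Finset.sum_congr rfl fun j _ => Finset.sum_congr rfl fun l _ => ?_
    rw [hg]
    simp only
    rw [smul_mul_smul_comm, mul_mul_mul_comm]
  have hvan : ∀ j l, N + 1 ≤ j + l → g j l = 0 := by
    intro j l hjl
    rw [hg]
    simp only
    rcases le_or_gt a j with hj | hj
    · rw [cwpow_eq_zero D ha hj hF, zero_mul, mul_zero, smul_zero]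
    · have hl : b ≤ l := by omega
      rw [cwpow_eq_zero D hb hl hG, mul_zero, mul_zero, smul_zero]
  rw [hexp, sum_range_sq_eq_triangle g N hvan, Hx_apply, Finset.mul_sum]
  refine Finset.sum_congr rfl fun k hk => ?_
  have hkN : k ≤ N := Nat.lt_succ_iff.1 (Finset.mem_range.1 hk)
  rw [cwpow_mul D hD, Finset.mul_sum, Finset.smul_sum, Finset.mul_sum]
  refine Finset.sum_congr rfl fun j hj => ?_
  have hjk : j ≤ k := Nat.lt_succ_iff.1 (Finset.mem_range.1 hj)
  rw [hg]
  simp only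
  rw [mul_smul_comm, mul_smul_comm, mul_smul_comm, smul_smul, ← mul_assoc (X ^ N) (X ^ (N - k)), ← pow_add,
    ← pow_add, inv_fact_mul_inv_fact hjk, show N - j + (N - (k - j)) = N + (N - k) by omega]

/-- **Changing the truncation order**: on families killed by `D^{N+1}`, `Hx D (N+1) = ε · Hx D N`; so the
lattices (and limits) defined through different admissible truncation orders coincide. -/
theorem Hx_succ_eq {S : Submodule K (MvPolynomial σ K)} (hnil : ∀ f ∈ S, (D ^ (N + 1)) f = 0)
    {F : (MvPolynomial σ K)[X]} (hF : F ∈ famOf S) : Hx D (N + 1) F = X * Hx D N F := by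
  rw [Hx_apply, Hx_apply, Finset.sum_range_succ, cwpow_eq_zero D hnil le_rfl hF, mul_zero, smul_zero, add_zero,
    Finset.mul_sum]
  refine Finset.sum_congr rfl fun k hk => ?_
  have hkN : k ≤ N := Nat.lt_succ_iff.1 (Finset.mem_range.1 hk)
  rw [mul_smul_comm, ← mul_assoc, ← pow_succ', show N + 1 - k = N - k + 1 by omega]

end ExpAlg

end BorelLimit


/-- **Part 4 of `stub_borelNormalForm` (registered helper stub): `exp(-D/ε) exp(D/ε) = 1`, scaled.** -/
theorem stub_borelNormalForm_expalg : ∀ {K : Type} [Field K] [CharZero K] {σ : Type}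
    (D : MvPolynomial σ K →ₗ[K] MvPolynomial σ K) (N : ℕ) {S : Submodule K (MvPolynomial σ K)},
    (∀ f ∈ S, (D ^ (N + 1)) f = 0) → ∀ {F : Polynomial (MvPolynomial σ K)}, F ∈ BorelLimit.famOf S →
    BorelLimit.Hx (-D) N (BorelLimit.Hx D N F) = Polynomial.X ^ (2 * N) * F :=
  fun D N _ hnil _ hF => BorelLimit.Hx_neg_Hx D N hnil hF

end Summit.MatrixMultiplication.MatrixMultiplication.Theorems.SymbolicSquare

end
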